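import Mathlib
import Summits.KontsevichZagierPeriods.KontsevichZagierPeriods.Theorems.IsogenyCertificatesRichelotChainCerts
import Summits.KontsevichZagierPeriods.KontsevichZagierPeriods.Theorems.IsogenyCertificatesRichelotChainCorr

/-!
# `RichelotChain` (stmt-KontsevichZagierPeriods-6732): the interval `(10, 34) ↔ (13, 30)`

Middle bounded root intervals of `Ĉ : w² = F̂(z) = (z+15)(z−9)(z−10)(z−34)(z−36)(z−60)` and
`C : y² = F(x) = x(x−6)(x−13)(x−30)(x−40)(x−45)` (`F̂ < 0`, `F < 0` there):
`[(10,34), (α+βz)/√|F̂|] ~ [(13,30), (α+βx)/√|F|]`, by the two real sheets of the SECOND Richelot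
correspondence `Z₂ : Φ¹(x,z) = 0` (`Φ¹ = (G₁L₁ + G₃L₃)/25`) over `z ∈ (10,13)` and `z ∈ (13,34)`,
each the smaller `x`-root of `Φ¹(·,z)` (the larger lies in `(40,45)`), mapping onto `(13,30)`; trace
certificate `cert1_trace_x` (`κ = −1`). Interval-specific sign bookkeeping:
`disc_x Φ¹ = (101z−984)(53z−528)(z−36)(z−60)`, `disc_z Φ¹ = 24(x−6)(x−13)(35x−1536)(7x−312)`,
`Φ¹(13,z) = 1326(z−13)²`, `Φ¹(30,z) = 918(z−10)(z−34)`, `Φ¹(40,z) = 408(z−10)(z−34)`,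
`Φ¹(45,z) = 78(z+15)(z−9)`, `Φ¹(x,10) = 26(x−30)(x−40)`, `Φ¹(x,13) = 7(x−13)(35x−1536)`,
`Φ¹(x,x) = −(x−6)(x−13)(x−36)(x−60)`, `Φ¹(x,34) = 1274(x−30)(x−40)`.

References: J.-B. Bost, J.-F. Mestre, Gaz. Math. 38 (1988), §2; M. Kontsevich, D. Zagier, *Periods*
(2001), §1.2.
-/

noncomputable section

open Set MeasureTheory
open Literature.NumberTheory.Transcendental Literature.ModelTheory.ExponentialFields

namespace Summit.KontsevichZagierPeriods.IsogenyCertificates.RichelotChain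

/-- **`RichelotChain`, interval `k = 2`:** `[(10,34), (α+βz)/√|F̂|] ~ [(13,30), 1·(α+βx)/√|F|]`.
[cite: BostMestre1988, §2] -/
theorem sheet_k2 (α β : ℚ) (r r' : KZ.IntegralRep 1)
    (h1 : r.domain = {z | (10 : ℝ) < z 0 ∧ z 0 < 34})
    (h2 : EqOn r.integrand (fun z => ((α : ℝ) + (β : ℝ) * z 0) /
      Real.sqrt |(z 0 + 15) * (z 0 - 9) * (z 0 - 10) * (z 0 - 34) * (z 0 - 36) * (z 0 - 60)|) r.domain)
    (h3 : r'.domain = {x | (13 : ℝ) < x 0 ∧ x 0 < 30})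
    (h4 : EqOn r'.integrand (fun x => (1 : ℝ) * ((α : ℝ) + (β : ℝ) * x 0) /
      Real.sqrt |x 0 * (x 0 - 6) * (x 0 - 13) * (x 0 - 30) * (x 0 - 40) * (x 0 - 45)|) r'.domain) :
    KZ.Equivalent r r' := by
  -- the data of the correspondence `Z₂`, in the `x`-root direction
  set a : ℝ → ℝ := fun t => -t ^ 2 + 96 * t - 834 with ha_def
  set b : ℝ → ℝ := fun t => 19 * t ^ 2 - 4476 * t + 41040 with hb_def
  set c : ℝ → ℝ := fun t => 1248 * t ^ 2 + 7488 * t - 168480 with hc_def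
  set a₁ : ℝ → ℝ := fun t => -2 * t + 96 with ha₁_def
  set b₁ : ℝ → ℝ := fun t => 38 * t - 4476 with hb₁_def
  set c₁ : ℝ → ℝ := fun t => 2496 * t + 7488 with hc₁_def
  set P : ℝ → ℝ := fun y => -y ^ 2 + 19 * y + 1248 with hP_def
  set Q : ℝ → ℝ := fun y => 96 * y ^ 2 - 4476 * y + 7488 with hQ_def
  set R : ℝ → ℝ := fun y => -834 * y ^ 2 + 41040 * y - 168480 with hR_def
  set Ft : ℝ → ℝ := fun y => y * (y - 6) * (y - 13) * (y - 30) * (y - 40) * (y - 45) with hFt_def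
  set Fs : ℝ → ℝ := fun t => (t + 15) * (t - 9) * (t - 10) * (t - 34) * (t - 36) * (t - 60) with hFs_def
  set Ψ : ℝ → ℝ → ℝ := fun y t => -51 * y * (y - 45) * (t - 10) * (t - 34) * (y - t) with hΨ_def
  have defs : (∀ t, a t = -t ^ 2 + 96 * t - 834) ∧ (∀ t, b t = 19 * t ^ 2 - 4476 * t + 41040) ∧
      (∀ t, c t = 1248 * t ^ 2 + 7488 * t - 168480) ∧ (∀ t, a₁ t = -2 * t + 96) ∧
      (∀ t, b₁ t = 38 * t - 4476) ∧ (∀ t, c₁ t = 2496 * t + 7488) ∧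
      (∀ y, P y = -y ^ 2 + 19 * y + 1248) ∧ (∀ y, Q y = 96 * y ^ 2 - 4476 * y + 7488) ∧
      (∀ y, R y = -834 * y ^ 2 + 41040 * y - 168480) ∧
      (∀ y, Ft y = y * (y - 6) * (y - 13) * (y - 30) * (y - 40) * (y - 45)) ∧
      (∀ t, Fs t = (t + 15) * (t - 9) * (t - 10) * (t - 34) * (t - 36) * (t - 60)) ∧
      (∀ y t, Ψ y t = -51 * y * (y - 45) * (t - 10) * (t - 34) * (y - t)) :=
    ⟨fun _ => rfl, fun _ => rfl, fun _ => rfl, fun _ => rfl, fun _ => rfl, fun _ => rfl, fun _ => rfl,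
      fun _ => rfl, fun _ => rfl, fun _ => rfl, fun _ => rfl, fun _ _ => rfl⟩
  obtain ⟨ea, eb, ec, ea₁, eb₁, ec₁, eP, eQ, eR, eFt, eFs, eΨ⟩ := defs
  -- hypotheses of `correspondence_transfer`
  have hexp : ∀ y t : ℝ, a t * y ^ 2 + b t * y + c t = P y * t ^ 2 + Q y * t + R y := by
    intro y t; rw [ea, eb, ec, eP, eQ, eR]; ring
  have hda : ∀ t, HasDerivAt a (a₁ t) t := fun t =>
    (hasDerivAt_quad (-1) 96 (-834) t (fun u => by rw [ea]; ring)).congr_deriv (by rw [ea₁]; ring)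
  have hdb : ∀ t, HasDerivAt b (b₁ t) t := fun t =>
    (hasDerivAt_quad 19 (-4476) 41040 t (fun u => by rw [eb]; ring)).congr_deriv (by rw [eb₁]; ring)
  have hdc : ∀ t, HasDerivAt c (c₁ t) t := fun t =>
    (hasDerivAt_quad 1248 7488 (-168480) t (fun u => by rw [ec]; ring)).congr_deriv (by rw [ec₁]; ring)
  have hsa : ∀ σ : Set (Fin 1 → ℝ), IsSemialgebraic ℚ σ → IsSemialgebraicFunOn ℚ σ (fun p => a (p 0)) :=
    fun σ hσ => poly_semialgebraic hσ (-MvPolynomial.X 0 ^ 2 + 96 * MvPolynomial.X 0 - 834) a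
      (fun x => by rw [ea]; simp)
  have hsb : ∀ σ : Set (Fin 1 → ℝ), IsSemialgebraic ℚ σ → IsSemialgebraicFunOn ℚ σ (fun p => b (p 0)) :=
    fun σ hσ => poly_semialgebraic hσ (19 * MvPolynomial.X 0 ^ 2 - 4476 * MvPolynomial.X 0 + 41040) b
      (fun x => by rw [eb]; simp)
  have hsc : ∀ σ : Set (Fin 1 → ℝ), IsSemialgebraic ℚ σ → IsSemialgebraicFunOn ℚ σ (fun p => c (p 0)) :=
    fun σ hσ => poly_semialgebraic hσ (1248 * MvPolynomial.X 0 ^ 2 + 7488 * MvPolynomial.X 0 - 168480) c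
      (fun x => by rw [ec]; simp)
  have hsa₁ : ∀ σ : Set (Fin 1 → ℝ), IsSemialgebraic ℚ σ → IsSemialgebraicFunOn ℚ σ (fun p => a₁ (p 0)) :=
    fun σ hσ => poly_semialgebraic hσ (-2 * MvPolynomial.X 0 + 96) a₁ (fun x => by rw [ea₁]; simp)
  have hsb₁ : ∀ σ : Set (Fin 1 → ℝ), IsSemialgebraic ℚ σ → IsSemialgebraicFunOn ℚ σ (fun p => b₁ (p 0)) :=
    fun σ hσ => poly_semialgebraic hσ (38 * MvPolynomial.X 0 - 4476) b₁ (fun x => by rw [eb₁]; simp)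
  have hsc₁ : ∀ σ : Set (Fin 1 → ℝ), IsSemialgebraic ℚ σ → IsSemialgebraicFunOn ℚ σ (fun p => c₁ (p 0)) :=
    fun σ hσ => poly_semialgebraic hσ (2496 * MvPolynomial.X 0 + 7488) c₁ (fun x => by rw [ec₁]; simp)
  have hΦP : ∀ y t : ℝ, a t * y ^ 2 + b t * y + c t = 0 →
      (-y ^ 2 + 19 * y + 1248) * t ^ 2 + (96 * y ^ 2 - 4476 * y + 7488) * t
        + (-834 * y ^ 2 + 41040 * y - 168480) = 0 := by
    intro y t h; rw [ea, eb, ec] at h; linear_combination h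
  have hnorm : ∀ y t : ℝ, a t * y ^ 2 + b t * y + c t = 0 → Ft y * Fs t = Ψ y t ^ 2 := by
    intro y t h
    have c0 := cert1_norm y t
    rw [hΦP y t h, zero_mul, sub_eq_zero] at c0
    rw [eFt, eFs, eΨ]
    linear_combination c0
  have hcert : ∀ y t : ℝ, a t * y ^ 2 + b t * y + c t = 0 →
      Ft y * (2 * a t * y + b t) + (-1) * (P y * (y + t) + Q y) * Ψ y t = 0 := by
    intro y t h
    have c0 := cert1_trace_x y t
    rw [hΦP y t h, zero_mul] at c0
    rw [eFt, ea, eb, eP, eQ, eΨ]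
    linear_combination c0
  have ha : ∀ t : ℝ, ((10 : ℚ) : ℝ) < t → t < ((34 : ℚ) : ℝ) → 0 < a t := by
    intro t h1 h2
    push_cast at h1 h2
    rw [ea]
    nlinarith [mul_pos (by linarith : (0 : ℝ) < t - 10) (by linarith : (0 : ℝ) < 34 - t)]
  have hd : ∀ t : ℝ, ((10 : ℚ) : ℝ) < t → t < ((34 : ℚ) : ℝ) → t ≠ ((13 : ℚ) : ℝ) →
      0 < b t ^ 2 - 4 * a t * c t := by
    intro t h1 h2 _
    push_cast at h1 h2
    rw [ea, eb, ec, show (19 * t ^ 2 - 4476 * t + 41040) ^ 2 - 4 * (-t ^ 2 + 96 * t - 834) *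
        (1248 * t ^ 2 + 7488 * t - 168480) = (101 * t - 984) * (53 * t - 528) * (36 - t) * (60 - t) by ring]
    exact mul_pos (mul_pos (mul_pos (by linarith) (by linarith)) (by linarith)) (by linarith)
  -- the quadratic in `x` over a point `t` of the source: continuity and values at 13, 30, 40, 45
  have hcx : ∀ t : ℝ, Continuous (fun y : ℝ => a t * y ^ 2 + b t * y + c t) := by
    intro t; rw [ea, eb, ec]; fun_prop
  have hv13 : ∀ t : ℝ, a t * (13 : ℝ) ^ 2 + b t * 13 + c t = 1326 * (t - 13) ^ 2 := by
    intro t; rw [ea, eb, ec]; ring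
  have hv30 : ∀ t : ℝ, a t * (30 : ℝ) ^ 2 + b t * 30 + c t = 918 * (t - 10) * (t - 34) := by
    intro t; rw [ea, eb, ec]; ring
  have hv40 : ∀ t : ℝ, a t * (40 : ℝ) ^ 2 + b t * 40 + c t = 408 * (t - 10) * (t - 34) := by
    intro t; rw [ea, eb, ec]; ring
  have hv45 : ∀ t : ℝ, a t * (45 : ℝ) ^ 2 + b t * 45 + c t = 78 * (t + 15) * (t - 9) := by
    intro t; rw [ea, eb, ec]; ring
  have hyroots : ∀ t : ℝ, ((10 : ℚ) : ℝ) < t → t < ((34 : ℚ) : ℝ) → t ≠ ((13 : ℚ) : ℝ) →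
      (∃ y : ℝ, ((13 : ℚ) : ℝ) < y ∧ y < ((30 : ℚ) : ℝ) ∧ a t * y ^ 2 + b t * y + c t = 0) ∧
        ∃ y' : ℝ, ((40 : ℚ) : ℝ) < y' ∧ y' < ((45 : ℚ) : ℝ) ∧ a t * y' ^ 2 + b t * y' + c t = 0 := by
    intro t ht1 ht2 ht0
    push_cast at ht1 ht2 ht0 ⊢
    have hneg : (t - 10) * (t - 34) < 0 := mul_neg_of_pos_of_neg (by linarith) (by linarith)
    have hpos : 0 < (t + 15) * (t - 9) := mul_pos (by linarith) (by linarith)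
    have hsq : 0 < (t - 13) ^ 2 := by
      have : t - 13 ≠ 0 := sub_ne_zero.mpr ht0
      positivity
    constructor
    · have h0 : (0 : ℝ) ∈ Ioo (a t * (30 : ℝ) ^ 2 + b t * 30 + c t) (a t * (13 : ℝ) ^ 2 + b t * 13 + c t) := by
        rw [hv13, hv30]
        exact ⟨by nlinarith, by nlinarith⟩
      obtain ⟨y, hy, hy0⟩ := intermediate_value_Ioo' (show (13 : ℝ) ≤ 30 by norm_num) (hcx t).continuousOn h0
      exact ⟨y, hy.1, hy.2, hy0⟩
    · have h0 : (0 : ℝ) ∈ Ioo (a t * (40 : ℝ) ^ 2 + b t * 40 + c t) (a t * (45 : ℝ) ^ 2 + b t * 45 + c t) := by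
        rw [hv40, hv45]
        exact ⟨by nlinarith, by nlinarith⟩
      obtain ⟨y, hy, hy0⟩ := intermediate_value_Ioo (show (40 : ℝ) ≤ 45 by norm_num) (hcx t).continuousOn h0
      exact ⟨y, hy.1, hy.2, hy0⟩
  have hsep : ∀ y y' : ℝ, ((13 : ℚ) : ℝ) < y → y < ((30 : ℚ) : ℝ) → ((40 : ℚ) : ℝ) < y' → y' < ((45 : ℚ) : ℝ) →
      0 < (((-1 : ℚ)) : ℝ) * (y - y') := by
    intro y y' _ hy hy' _
    push_cast at hy hy' ⊢
    nlinarith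
  have hP : ∀ y : ℝ, ((13 : ℚ) : ℝ) < y → y < ((30 : ℚ) : ℝ) → P y ≠ 0 := by
    intro y h1 h2
    push_cast at h1 h2
    rw [eP]
    nlinarith [mul_pos (by linarith : (0 : ℝ) < y - 13) (by linarith : (0 : ℝ) < 30 - y)]
  -- the quadratic in `t` over a point `y` of the target: continuity and values at 10, 13, y, 34
  have hct : ∀ y : ℝ, Continuous (fun t : ℝ => a t * y ^ 2 + b t * y + c t) := by
    intro y; simp only [ea, eb, ec]; fun_prop
  have hw10 : ∀ y : ℝ, a 10 * y ^ 2 + b 10 * y + c 10 = 26 * (y - 30) * (y - 40) := by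
    intro y; rw [ea, eb, ec]; ring
  have hw13 : ∀ y : ℝ, a 13 * y ^ 2 + b 13 * y + c 13 = 7 * (y - 13) * (35 * y - 1536) := by
    intro y; rw [ea, eb, ec]; ring
  have hwy : ∀ y : ℝ, a y * y ^ 2 + b y * y + c y = -((y - 6) * (y - 13) * (y - 36) * (y - 60)) := by
    intro y; rw [ea, eb, ec]; ring
  have hw34 : ∀ y : ℝ, a 34 * y ^ 2 + b 34 * y + c 34 = 1274 * (y - 30) * (y - 40) := by
    intro y; rw [ea, eb, ec]; ring
  have htroots : ∀ y : ℝ, ((13 : ℚ) : ℝ) < y → y < ((30 : ℚ) : ℝ) →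
      (∃ t : ℝ, ((10 : ℚ) : ℝ) < t ∧ t < ((13 : ℚ) : ℝ) ∧ t < y ∧ a t * y ^ 2 + b t * y + c t = 0) ∧
        ∃ t : ℝ, ((13 : ℚ) : ℝ) < t ∧ t < ((34 : ℚ) : ℝ) ∧ y < t ∧ a t * y ^ 2 + b t * y + c t = 0 := by
    intro y hy1 hy2
    push_cast at hy1 hy2 ⊢
    have hpos : 0 < (y - 30) * (y - 40) := mul_pos_of_neg_of_neg (by linarith) (by linarith)
    constructor
    · -- a root in (10, 13): Φ¹(y,10) = 26(y−30)(y−40) > 0 > Φ¹(y,13) = 7(y−13)(35y−1536)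
      have h0 : (0 : ℝ) ∈ Ioo (a 13 * y ^ 2 + b 13 * y + c 13) (a 10 * y ^ 2 + b 10 * y + c 10) := by
        rw [hw10, hw13]
        refine ⟨?_, by nlinarith⟩
        nlinarith [mul_pos (by linarith : (0 : ℝ) < y - 13) (by linarith : (0 : ℝ) < 1536 - 35 * y)]
      obtain ⟨t, ht, ht0⟩ := intermediate_value_Ioo' (show (10 : ℝ) ≤ 13 by norm_num) (hct y).continuousOn h0
      exact ⟨t, ht.1, ht.2, by linarith [ht.2], ht0⟩
    · -- a root in (y, 34): Φ¹(y,y) = −(y−6)(y−13)(y−36)(y−60) < 0 < Φ¹(y,34) = 1274(y−30)(y−40)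
      have h0 : (0 : ℝ) ∈ Ioo (a y * y ^ 2 + b y * y + c y) (a 34 * y ^ 2 + b 34 * y + c 34) := by
        rw [hwy, hw34]
        refine ⟨?_, by nlinarith⟩
        have h1 : 0 < (y - 6) * (y - 13) := mul_pos (by linarith) (by linarith)
        have h2 : 0 < (y - 36) * (y - 60) := mul_pos_of_neg_of_neg (by linarith) (by linarith)
        nlinarith [mul_pos h1 h2]
      obtain ⟨t, ht, ht0⟩ := intermediate_value_Ioo (show y ≤ 34 by linarith) (hct y).continuousOn h0
      exact ⟨t, by linarith [ht.1], ht.2, ht.1, ht0⟩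
  have hDz : ∀ y : ℝ, ((13 : ℚ) : ℝ) < y → y < ((30 : ℚ) : ℝ) → Q y ^ 2 - 4 * P y * R y ≠ 0 := by
    intro y hy1 hy2
    push_cast at hy1 hy2
    rw [eP, eQ, eR, show (96 * y ^ 2 - 4476 * y + 7488) ^ 2 - 4 * (-y ^ 2 + 19 * y + 1248) *
        (-834 * y ^ 2 + 41040 * y - 168480) = 24 * (y - 6) * (y - 13) * (35 * y - 1536) * (7 * y - 312) by ring]
    refine mul_ne_zero (mul_ne_zero (mul_ne_zero (mul_ne_zero (by norm_num) ?_) ?_) ?_) ?_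
    · exact (by linarith : (0 : ℝ) < y - 6).ne'
    · exact (by linarith : (0 : ℝ) < y - 13).ne'
    · exact (by linarith : 35 * y - 1536 < 0).ne
    · exact (by linarith : 7 * y - 312 < 0).ne
  have hFt : ∀ y : ℝ, ((13 : ℚ) : ℝ) < y → y < ((30 : ℚ) : ℝ) → Ft y ≠ 0 := by
    intro y hy1 hy2
    push_cast at hy1 hy2
    rw [eFt]
    refine mul_ne_zero (mul_ne_zero (mul_ne_zero (mul_ne_zero (mul_ne_zero ?_ ?_) ?_) ?_) ?_) ?_
    · exact (by linarith : (0 : ℝ) < y).ne'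
    · exact (by linarith : (0 : ℝ) < y - 6).ne'
    · exact (by linarith : (0 : ℝ) < y - 13).ne'
    · exact (by linarith : y - 30 < 0).ne
    · exact (by linarith : y - 40 < 0).ne
    · exact (by linarith : y - 45 < 0).ne
  have hFs : ∀ t : ℝ, ((10 : ℚ) : ℝ) < t → t < ((34 : ℚ) : ℝ) → t ≠ ((13 : ℚ) : ℝ) → Fs t ≠ 0 := by
    intro t ht1 ht2 _
    push_cast at ht1 ht2
    rw [eFs]
    refine mul_ne_zero (mul_ne_zero (mul_ne_zero (mul_ne_zero (mul_ne_zero ?_ ?_) ?_) ?_) ?_) ?_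
    · exact (by linarith : (0 : ℝ) < t + 15).ne'
    · exact (by linarith : (0 : ℝ) < t - 9).ne'
    · exact (by linarith : (0 : ℝ) < t - 10).ne'
    · exact (by linarith : t - 34 < 0).ne
    · exact (by linarith : t - 36 < 0).ne
    · exact (by linarith : t - 60 < 0).ne
  have hr : r.domain = {p | ((10 : ℚ) : ℝ) < p 0 ∧ p 0 < ((34 : ℚ) : ℝ)} := by push_cast; exact h1
  have hs : r'.domain = {p | ((13 : ℚ) : ℝ) < p 0 ∧ p 0 < ((30 : ℚ) : ℝ)} := by push_cast; exact h3
  have hg : EqOn r.integrand (fun p => 1 * ((α : ℝ) + (β : ℝ) * p 0) / Real.sqrt |Fs (p 0)|) r.domain := by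
    intro p hp; rw [h2 hp]; beta_reduce; rw [eFs, one_mul]
  have hf : EqOn r'.integrand (fun p => 1 * ((α : ℝ) + (β : ℝ) * p 0) / Real.sqrt |Ft (p 0)|) r'.domain := by
    intro p hp; rw [h4 hp]
  exact correspondence_transfer a b c a₁ b₁ c₁ P Q R Ft Fs Ψ (-1) 1 1 (α : ℝ) (β : ℝ) (-1) 10 13 34 13 30 40 45
    r r' (Or.inl rfl) (by norm_num) (by norm_num) hexp hda hdb hdc hsa hsb hsc hsa₁ hsb₁ hsc₁ hnorm hcert
    (by simp) ha hd hyroots hsep hP htroots hDz hFt hFs hr hg hs hf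

end Summit.KontsevichZagierPeriods.IsogenyCertificates.RichelotChain

end
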